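import Summits.ResolutionOfSingularities.ResolutionOfSingularities.Theses.SectionAscent
import Summits.ResolutionOfSingularities.ResolutionOfSingularities.Theorems.SectionAscentAffineToGlobalRegularYardstick
import Summits.ResolutionOfSingularities.ResolutionOfSingularities.Theorems.SectionAscentAffineToGlobalYardstickCharts
import Summits.ResolutionOfSingularities.ResolutionOfSingularities.Theorems.SectionAscentAffineToGlobalFibreBaseLocalization
import Summits.ResolutionOfSingularities.ResolutionOfSingularities.Theorems.SectionAscentAffineToGlobalPhasedPatching
import HarnessLib

/-!
# Crux `AffineToGlobal` (stmt-ResolutionOfSingularities-15961), line `Sketch` (regular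
# yardsticks), reshape 2: the crux CLOSED MODULO the FIBRE kernel

Route `ResolutionOfSingularities/SectionAscent`, crux `AffineToGlobal`
(`Summit.ResolutionOfSingularities.ResolutionOfSingularities.Theses.SectionAscent.AffineToGlobal`:
affine `Sing`-exact one-shot resolutions in characteristic `p`, all dimensions and all fields
("H") ⇒ `ResolutionInChar p`). Support file (`--supports stmt-ResolutionOfSingularities-15961`):
the composition of the lead's skeleton `Cruxes/AffineToGlobal/Lines/Sketch.lean` (reshape 2)
with its three TRUE stubs landed (`YardstickCharts.stub_yardstickCharts`,
`FibreBaseLocalization.stub_fibreBaseLocalization`, `PhasedPatching.stub_phasedPatching`),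
leaving the crux conditional on exactly one statement, the FIBRE KERNEL

  fibreKernel(p): for every integral `X` of finite type over a field of characteristic `p`,
  every REGULAR point `x ∈ X` and every blow-up `S' → Spec 𝒪_{X,x}` singular only over the
  closed point (and at infinitely many points), there is a blow-up `S'' → S'` with regular
  source whose centre lies over the closed point

— formally weaker than the `Sing`-supported kernel RIGreg of reshape 1
(`RegularYardstick.affineToGlobal_of_regularKernel`, Temkin's condition (iii) at regular
stalks): the centre need not lie inside `Sing S'`. Both are implied by Temkin-strong resolution
in characteristic `p` and are open from dimension 4 on; in dimension 3 Cossart–Piltant 2019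
give the modification form, not the blow-up form (loc. cit. p. 3).

**Proof of `resolutionInChar_of_fibreKernel`.** By the landed projective reduction it suffices
to resolve an integral `Y` of finite type over `k`. CHARTS (`stub_yardstickCharts`, the only use
of H): finitely many open charts `φ i : T i ↪ Y` covering `Y`, one-shot blow-ups
`b i : R i → T i` with `R i` regular integral of finite type, and the join `σ₀ : S₀ → Y` (a
blow-up along `J ≠ ⊥`) on which every extended centre is an effective Cartier divisor. PHASES
(`stub_phasedPatching`): treat the yardsticks one at a time; in phase `i` the current model over
the chart `T i` is a blow-up of `R i` (Stacks 080A factorisation), `stub_fibreBaseLocalization`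
(Temkin 2008 Prop. 2.3.4 (iii)⇒(ii) run over the base `R i`, local moves fed by the kernel at
the regular points of `R i`) returns one blow-up with regular source and centre over the bad
locus, which lies over `Y ∖ ⋃_{j<i} φ j (T j)`, so its maximal extension does not touch the
earlier phases; after the last phase the model is regular, proper and birational over `Y`.

## Sources

* M. Temkin, *Desingularization of quasi-excellent schemes in characteristic zero*, Adv. Math.
  219 (2008), Prop. 2.3.4, Lemma 2.1.1, Lemma 2.1.4. [Temkin2008]
* The Stacks Project, Tags 080A, 080B. [StacksProject]
* V. Cossart, O. Piltant, *Resolution of singularities of arithmetical threefolds*, J. Algebra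
  529 (2019), Thm. 1.1 and p. 3. [CossartPiltant2019]
-/

noncomputable section

set_option linter.dupNamespace false -- mandated namespace of this single-conjunct summit

open CategoryTheory CategoryTheory.Limits AlgebraicGeometry TopologicalSpace IsLocalRing
open Literature.AlgebraicGeometry.Resolution

namespace Summit.ResolutionOfSingularities.ResolutionOfSingularities.Theorems.AffineToGlobal.PhasedYardstick

/-- **The fibre-form local condition from the kernel (infinite case) and H (finite case).**
At a regular point `x` of an integral variety of characteristic `p`, a blow-up `S'` of
`Spec 𝒪_{X,x}` singular only over the closed point has a blow-up with regular source and centre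
over the closed point: if `Sing S'` is finite this is the landed
`AffineSingularLocus.stub_finiteSingularLocus` (a `Sing`-supported desingularization, whose
centre lies over the closed point because `Sing S'` does), otherwise the kernel.
[cite: Temkin2008, Prop. 2.3.4] -/
theorem fibreLocal_of_kernel (p : ℕ) (hp : p.Prime)
    (h : ∀ d : ℕ, ∀ (K : Type) [Field K] [CharP K p] (A : Type) [CommRing A] [IsDomain A]
      [Algebra K A] [Algebra.FiniteType K A], ringKrullDim A < (d : WithBot ℕ∞) →
      ∃ I : Ideal A, I ≠ ⊥ ∧
        Literature.AlgebraicGeometry.Resolution.Scheme.IsRegular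
          (Literature.AlgebraicGeometry.Resolution.affineBlowup I) ∧
        ∀ 𝔭 : PrimeSpectrum A, I ≤ 𝔭.asIdeal ↔
          ¬ IsRegularLocalRing (Localization.AtPrime 𝔭.asIdeal))
    (hker : ∀ (K : Type) [Field K] [CharP K p] (X : Scheme.{0}) [IsIntegral X]
      (f : X ⟶ Spec (.of K)) [LocallyOfFiniteType f] [QuasiCompact f] (x : X),
      x ∈ Scheme.regularLocus X →
      ∀ (S' : Scheme.{0}) (g : S' ⟶ Spec (X.presheaf.stalk x))
        (I : (Spec (X.presheaf.stalk x)).IdealSheafData), IsBlowup g I →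
        (∀ s : S', s ∉ Scheme.regularLocus S' → g s = closedPoint (X.presheaf.stalk x)) →
        (Scheme.regularLocus S')ᶜ.Infinite →
        ∃ (S'' : Scheme.{0}) (g' : S'' ⟶ S') (I' : S'.IdealSheafData), IsBlowup g' I' ∧
          (∀ s ∈ I'.support, g s = closedPoint (X.presheaf.stalk x)) ∧ Scheme.IsRegular S'')
    (K : Type) [Field K] [CharP K p] (X : Scheme.{0}) [IsIntegral X] (f : X ⟶ Spec (.of K))
    [LocallyOfFiniteType f] [QuasiCompact f] (x : X) (hx : x ∈ Scheme.regularLocus X)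
    (S' : Scheme.{0}) (g : S' ⟶ Spec (X.presheaf.stalk x))
    (I : (Spec (X.presheaf.stalk x)).IdealSheafData) (hg : IsBlowup g I)
    (hs : ∀ s : S', s ∉ Scheme.regularLocus S' → g s = closedPoint (X.presheaf.stalk x)) :
    ∃ (S'' : Scheme.{0}) (g' : S'' ⟶ S') (I' : S'.IdealSheafData), IsBlowup g' I' ∧
      (∀ s ∈ I'.support, g s = closedPoint (X.presheaf.stalk x)) ∧ Scheme.IsRegular S'' := by
  by_cases hfin : (Scheme.regularLocus S')ᶜ.Finite
  · obtain ⟨S'', g', ⟨I', hg', hI'⟩, hreg⟩ :=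
      AffineSingularLocus.stub_finiteSingularLocus p hp h K X f x S' g I hg hfin
    exact ⟨S'', g', I', hg', fun s hs' => hs s (hI' hs'), hreg⟩
  · exact hker K X f x hx S' g I hg hs hfin

/-- **Resolution in characteristic `p` from H and the FIBRE kernel** (composition of line
`Sketch`, reshape 2): yardstick charts and their join (`stub_yardstickCharts`), phased patching
(`stub_phasedPatching`) with the per-yardstick conclusion of the fibre-form base localisation
(`stub_fibreBaseLocalization`) fed by the kernel at the (regular) points of the yardsticks
(`fibreLocal_of_kernel`), then the landed projective reduction
`WeightedThesis.ProjectiveIntegralSuffices.stub_projectiveIntegralSuffices`.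
[cite: Temkin2008, Prop. 2.3.4] [cite: StacksProject, Tag 080A] [cite: CossartPiltant2019, p. 3] -/
theorem resolutionInChar_of_fibreKernel (p : ℕ) (hp : p.Prime)
    (h : ∀ d : ℕ, ∀ (K : Type) [Field K] [CharP K p] (A : Type) [CommRing A] [IsDomain A]
      [Algebra K A] [Algebra.FiniteType K A], ringKrullDim A < (d : WithBot ℕ∞) →
      ∃ I : Ideal A, I ≠ ⊥ ∧
        Literature.AlgebraicGeometry.Resolution.Scheme.IsRegular
          (Literature.AlgebraicGeometry.Resolution.affineBlowup I) ∧
        ∀ 𝔭 : PrimeSpectrum A, I ≤ 𝔭.asIdeal ↔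
          ¬ IsRegularLocalRing (Localization.AtPrime 𝔭.asIdeal))
    (hker : ∀ (K : Type) [Field K] [CharP K p] (X : Scheme.{0}) [IsIntegral X]
      (f : X ⟶ Spec (.of K)) [LocallyOfFiniteType f] [QuasiCompact f] (x : X),
      x ∈ Scheme.regularLocus X →
      ∀ (S' : Scheme.{0}) (g : S' ⟶ Spec (X.presheaf.stalk x))
        (I : (Spec (X.presheaf.stalk x)).IdealSheafData), IsBlowup g I →
        (∀ s : S', s ∉ Scheme.regularLocus S' → g s = closedPoint (X.presheaf.stalk x)) →
        (Scheme.regularLocus S')ᶜ.Infinite →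
        ∃ (S'' : Scheme.{0}) (g' : S'' ⟶ S') (I' : S'.IdealSheafData), IsBlowup g' I' ∧
          (∀ s ∈ I'.support, g s = closedPoint (X.presheaf.stalk x)) ∧ Scheme.IsRegular S'') :
    ResolutionInChar.{0} p := by
  intro k _ _ X f hsep hlft hqc hred
  refine Theorems.WeightedThesis.ProjectiveIntegralSuffices.stub_projectiveIntegralSuffices k
    (fun n Y ι hι hint => ?_) X f hsep hlft hqc hred
  haveI := hι
  haveI := hint
  haveI : IsProper (Literature.AlgebraicGeometry.Motives.projectiveSpace n k).hom :=
    Literature.AlgebraicGeometry.Motives.isProper_projectiveSpace n k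
  let fY : Y ⟶ Spec (.of k) := ι ≫ (Literature.AlgebraicGeometry.Motives.projectiveSpace n k).hom
  haveI : LocallyOfFiniteType fY := inferInstance
  haveI : QuasiCompact fY := inferInstance
  obtain ⟨m, T, R, φ, hφ, b, 𝓘, fR, hRint, hRft, hRqc, S₀, σ₀, J, hcov, hb, hRreg, hJ, hσ₀,
    hcart⟩ := YardstickCharts.stub_yardstickCharts p h k Y fY
  refine PhasedPatching.stub_phasedPatching k Y fY m T R φ b 𝓘 hcov hb (fun i M π Q hπ => ?_) S₀ σ₀ J hJ hσ₀
    hcart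
  haveI := hRint i
  haveI := hRft i
  haveI := hRqc i
  exact FibreBaseLocalization.stub_fibreBaseLocalization k (R i) (fR i)
    (fun x S' g I hg hs => fibreLocal_of_kernel p hp h hker k (R i) (fR i) x
      ((Scheme.mem_regularLocus x).mpr (hRreg i x)) S' g I hg hs) M π Q hπ

/-- **The crux `AffineToGlobal` modulo the FIBRE kernel** (the registered open stub
`stub_fibreKernel` of line `Sketch`, verbatim as hypothesis): if, prime by prime, the crux's
hypothesis H implies fibreKernel(p), then `SectionAscent.AffineToGlobal` holds. CONDITIONAL
result; its hypothesis is open from dimension 4 on. [cite: Temkin2008, Prop. 2.3.4]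
[cite: CossartPiltant2019, p. 3] -/
theorem affineToGlobal_of_fibreKernel
    (hker : ∀ p : ℕ, p.Prime →
      (∀ d : ℕ, ∀ (K : Type) [Field K] [CharP K p] (A : Type) [CommRing A] [IsDomain A]
        [Algebra K A] [Algebra.FiniteType K A], ringKrullDim A < (d : WithBot ℕ∞) →
        ∃ I : Ideal A, I ≠ ⊥ ∧
          Literature.AlgebraicGeometry.Resolution.Scheme.IsRegular
            (Literature.AlgebraicGeometry.Resolution.affineBlowup I) ∧
          ∀ 𝔭 : PrimeSpectrum A, I ≤ 𝔭.asIdeal ↔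
            ¬ IsRegularLocalRing (Localization.AtPrime 𝔭.asIdeal)) →
      ∀ (K : Type) [Field K] [CharP K p] (X : Scheme.{0}) [IsIntegral X]
        (f : X ⟶ Spec (.of K)) [LocallyOfFiniteType f] [QuasiCompact f] (x : X),
        x ∈ Scheme.regularLocus X →
        ∀ (S' : Scheme.{0}) (g : S' ⟶ Spec (X.presheaf.stalk x))
          (I : (Spec (X.presheaf.stalk x)).IdealSheafData), IsBlowup g I →
          (∀ s : S', s ∉ Scheme.regularLocus S' → g s = closedPoint (X.presheaf.stalk x)) →
          (Scheme.regularLocus S')ᶜ.Infinite →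
          ∃ (S'' : Scheme.{0}) (g' : S'' ⟶ S') (I' : S'.IdealSheafData), IsBlowup g' I' ∧
            (∀ s ∈ I'.support, g s = closedPoint (X.presheaf.stalk x)) ∧
            Scheme.IsRegular S'') :
    Summit.ResolutionOfSingularities.ResolutionOfSingularities.Theses.SectionAscent.AffineToGlobal :=
  fun p hp hH => resolutionInChar_of_fibreKernel p hp hH (hker p hp hH)

/-- **The `Sing`-supported kernel implies the fibre kernel** pointwise: a desingularization in
Temkin's sense (centre inside `Sing S'`) of a blow-up `S'` singular only over the closed point
has its centre over the closed point. Hence reshape 2's residue is formally weaker than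
reshape 1's RIGreg. [cite: Temkin2008, Def. 2.2.6] -/
theorem fibreLocal_of_admitsDesingularization {B S' : Scheme.{0}} (g : S' ⟶ B) (x₀ : B)
    (hs : ∀ s : S', s ∉ Scheme.regularLocus S' → g s = x₀)
    (h : Scheme.AdmitsDesingularization S') :
    ∃ (S'' : Scheme.{0}) (g' : S'' ⟶ S') (I' : S'.IdealSheafData), IsBlowup g' I' ∧
      (∀ s ∈ I'.support, g s = x₀) ∧ Scheme.IsRegular S'' := by
  obtain ⟨S'', g', ⟨I', hg', hI'⟩, hreg⟩ := h
  exact ⟨S'', g', I', hg', fun s hs' => hs s (hI' hs'), hreg⟩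

end Summit.ResolutionOfSingularities.ResolutionOfSingularities.Theorems.AffineToGlobal.PhasedYardstick

end
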